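import Summits.Ventures.CertifiedArithmetic.LowPrec.DoubleRoundingProductUnderflow
import Summits.Ventures.CertifiedArithmetic.LowPrec.DoubleRoundingGmidBelow
import Summits.Ventures.CertifiedArithmetic.LowPrec.DoubleRoundingProductCells

/-!
# Double rounding of products through a register with the SAME quantum (THEOREM N-mul-0)

HONEST FRAMING (venture CertifiedArithmetic / cell `pub-lowprec`): certified error envelopes and
provably optimal rounding/accumulation schemes for low-precision formats under stated cost models;
every table by two implementations; no hardware or vendor claims.

The law of `DoubleRoundingProductLaw.lean` decides `DRMul φ ψ`
(`fl_φ (fl_ψ (a·b)) = fl_φ (a·b)` for all data of `φ`) for embedded pairs with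
`P_ψ ≥ 2 P_φ` at every POSITIVE exponent distance `d = L_φ - L_ψ ≥ 1` (`L = qexp`).  An
embedded pair has `d ≥ 0`; this file treats the remaining distance `d = 0` — a register with
the quantum of the element format and more precision:

* §1 THEOREM N-mul-0 (`not_drMul_of_qexp_eq`), for EVERY pair of records: `L_ψ = L_φ`,
  `m = m_φ ≥ 3` (`P_φ ≥ 4`), `m_ψ ≥ m + 1`, data `a = (2^(m-1) + 1)·2^α` and
  `b = (2^(m+1) - 1)·2^β` quanta of `φ` in range with `α + β = bias φ`, and
  `2^(m+1) + 4 ≤ M_φ`, `2^(m+1) + 3 ≤ M_ψ` `⟹ ¬ DRMul φ ψ`.  Mechanism (`q` = the common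
  quantum): `a · b = (2^(m+1) + 3 - 2^(1-m))·q` lies `2^(1-m) q < q/2` below
  `μ = (2^(m+1) + 3)·q`, a value of `ψ` (`μ < 2^(m_ψ + 1)`) and the MIDPOINT of the
  consecutive values `2^(m+1) + 2` (odd significand `2^m + 1`) and `2^(m+1) + 4` (even
  significand) of `φ`; so `fl_ψ (a·b) = μ ↦ 2^(m+1) + 4` (tie to even,
  `toRat_roundNE_gmid_odd`) while `fl_φ (a·b) = 2^(m+1) + 2` (`toRat_roundNE_below_gmid`).
  NO hypothesis `P_ψ ≥ 2 P_φ` and no inclusion of the value sets is needed.  WHY `d = 0` IS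
  THE STRIP IN DISGUISE: below `2^(m_ψ + 1)·q` the register holds every multiple of `q`, so on
  the binade `[2^(m+w), 2^(m+w+1))·q` of `φ` (spacing `2^w q`, `w ≥ 1`) it acts with the
  EFFECTIVE PRECISION `P_φ + w < 2 P_φ` of the product strip `P_φ < P_ψ < 2 P_φ`
  (`DoubleRoundingProductStrip.lean`, innocuous iff `P_φ ≤ 3` by implementation A): a product
  `K·2^-s·q` (`K = o_a o_b < 2^(2P)`, `1 ≤ s ≤ P - 1`) slips iff its nearest integer is a
  midpoint of `φ` on the side of the odd neighbour.  Below `2^(m+1)·q` the two grids coincide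
  (no slip); the witness of §1 is the smallest-magnitude uniform family (`w = 1`).
* §2 the hypothesis as a boolean test on records (`drMulSameQTest`, the exponent `α` searched
  over `[0, bias]`), its soundness, and the named `13 × 13` matrix: NO named pair is in this
  regime (`drMulSameQ_named`: equal quanta occur only for binary8pP vs binary8pPf, of equal
  precision) — the theorem is about register design, the case "accumulate in a register with
  the element format's quantum".
* §3 pseudo-record cells (implementation B by the kernel on `≤ 64`-value sources for the
  positive side, by §1 for the negative side): `P = 2` (`Z2 → Z2reg`, `P_ψ = 4`) and `P = 3`
  (`Z3 → Z3reg`, `P_ψ = 6`) are INNOCUOUS at `d = 0`; `P = 4` (`Z4 → Z4reg`, `P_ψ = 8`: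
  `5·2^α q · 15·2^β q = 75/4 q ↦ 19 q ↦ 20 q`, directly `18 q`) and `P = 8`
  (`Q8 → Q8reg`, `P_ψ = 16`, the bfloat16 precision with a same-quantum 16-bit-significand
  register) SLIP; and the innocuous precisions stay innocuous through the LESS precise
  same-quantum registers `P_φ < P_ψ < 2 P_φ` (`sameQ_strip_cells`: `Z2 → Z2r3` (`P_ψ = 3`),
  `Z3 → Z3r4`, `Z3 → Z3r5` (`P_ψ = 4, 5`), by the kernel).  So at `d = 0` the answer is a
  precision threshold and NOT a register-precision threshold: innocuous iff `P_φ ≤ 3`,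
  whatever `P_ψ > P_φ` (`P_φ ≥ 4`: §1 for every record and every `m_ψ > m_φ`; `P_φ ≤ 3`:
  these cells and implementation A on deep pseudo-records with
  `P_ψ ∈ {P+1, ⌈3P/2⌉, 2P, 2P+1, 3P}` and two ranges; a record-generic proof of the positive
  side is NOT in this file).

Two implementations: A = `code/enum/mul_sameq_law.py` (exact rationals; brute force of `DRMul`
on pseudo-records `2 ≤ P_φ ≤ 8` at `d = 0` against `P_φ ≤ 3` (`104` register rows, `0`
mismatches); the slip set against the integer midpoint condition above (`64` rows with
`P_ψ ≥ 2P`, equal); the family of §1 for `4 ≤ P_φ ≤ 64` (`1098` rows); the seven cells of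
§3 (`sameQ_embeds`, `sameQ_strip_embeds`); the named matrix) →
`certs/enum/DOUBLE-ROUNDING-MUL-SAMEQ.json`; B = the kernel (this file).
PLACEMENT — KNOWN: the general-midpoint mechanism ([MartinDorelMelquiondMuller2013] Property
2.1: a slip forces the intermediate result onto a midpoint of the target; [BoldoMelquiond2008]
Thm 3) and innocuous double rounding of products for `p₂ ≥ 2p₁` with `emin₂ ≤ 2 emin₁`
([Figueroa1995] §3; [Roux2014] Table II, in whose FLT convention `emin` is the exponent of
the quantum, so that the condition is `L_ψ ≤ 2 L_φ` = clause (E) and the same-quantum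
register is the opposite extreme `emin₂ = emin₁`).  We found no statement in print isolating
the same-quantum register and its source-precision threshold `p₁ ≤ 3` (searches logged in
`pub-lowprec-enum/FRESHNESS-ENUM.md` and `DOUBLE-ROUNDING-MUL.md` §10, 2026-08-21).
NEW here: the record-generic witness for `p₁ ≥ 4` at equal quanta and the observation that
gradual underflow of the register re-creates the product strip.  No hardware or vendor claims.
-/

namespace Summit.Ventures.CertifiedArithmetic

open Literature.ComputerArithmetic.FloatingPoint
open Literature.ComputerArithmetic.FloatingPoint.Format
open Literature.ComputerArithmetic.FloatingPoint.MiniFloat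

/-! ## §1 THEOREM N-mul-0: equal quanta, `P_φ ≥ 4` — some product slips -/

/-- THEOREM N-mul-0, WITNESS — for EVERY pair of format records with EQUAL quanta
(`L_ψ = L_φ`), `m = m_φ ≥ 3`, `m_ψ ≥ m + 1`: the data `a = (2^(m-1) + 1)·2^α` and
`b = (2^(m+1) - 1)·2^β` quanta of `φ` in range with `α + β = bias φ` (so that
`2^(α+β) · quantum φ = 2^(1-m)`), `2^(m+1) + 4 ≤ M_φ` and `2^(m+1) + 3 ≤ M_ψ`
`⟹ ¬ DRMul φ ψ`: `a · b = (2^(m+1) + 3)·q - 2^(1-m)·q` rounds in `ψ` UP to the midpoint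
`(2^(m+1) + 3)·q` of `φ`, which `φ` resolves to the even side `(2^(m+1) + 4)·q`, while
`fl_φ (a·b) = (2^(m+1) + 2)·q`.
No hypothesis on `P_ψ` beyond `m_ψ > m_φ`, no inclusion of the value sets.
[this packet; cite: MartinDorelMelquiondMuller2013, Property 2.1; cite: Figueroa1995, §3] -/
theorem not_drMul_of_qexp_eq {φ ψ : Format} (hq : ψ.qexp = φ.qexp) (h3 : 3 ≤ φ.manBits)
    (hP : φ.manBits + 1 ≤ ψ.manBits) {α β : ℕ} (hαβ : α + β = φ.bias)
    (ha : (2 ^ (φ.manBits - 1) + 1) * 2 ^ α ≤ φ.maxScaled)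
    (hb : (2 ^ (φ.manBits + 1) - 1) * 2 ^ β ≤ φ.maxScaled)
    (hX : 2 ^ (φ.manBits + 1) + 4 ≤ φ.maxScaled)
    (hY : 2 ^ (φ.manBits + 1) + 3 ≤ ψ.maxScaled) : ¬ DRMul φ ψ := by
  intro hD
  have hq0 := φ.quantum_pos
  have hQ : ψ.quantum = φ.quantum := by
    show (2 : ℚ) ^ ψ.qexp = (2 : ℚ) ^ φ.qexp
    rw [hq]
  have h1 : 1 ≤ φ.manBits := by omega
  have hpow : 2 ^ (φ.manBits + 1) = 2 * 2 ^ φ.manBits := pow_succ' 2 _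
  have hpow2 : 2 ^ (φ.manBits + 2) = 2 * 2 ^ (φ.manBits + 1) := pow_succ' 2 _
  have h8 : 8 ≤ 2 ^ φ.manBits := le_trans (by norm_num) (Nat.pow_le_pow_right (by norm_num) h3)
  have hmψ : 2 ^ (φ.manBits + 2) ≤ 2 ^ (ψ.manBits + 1) :=
    Nat.pow_le_pow_right (by norm_num) (by omega)
  have hhalf : 2 ^ (φ.manBits - 1) * 2 = 2 ^ φ.manBits := by
    rw [← pow_succ, Nat.sub_add_cancel h1]
  -- data
  obtain ⟨a, ha'⟩ := exists_toRat_eq_natMul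
    (representable_mul_pow (φ := φ) (k := 2 ^ (φ.manBits - 1) + 1) (j := α) (by omega) ha)
  obtain ⟨b, hb'⟩ := exists_toRat_eq_natMul
    (representable_mul_pow (φ := φ) (k := 2 ^ (φ.manBits + 1) - 1) (j := β) (by omega) hb)
  -- the unit: `2^α · 2^β · q = 2 / 2^m`
  have hunit : (2 : ℚ) ^ α * 2 ^ β * φ.quantum = 2 / 2 ^ φ.manBits := by
    have e : (2 : ℚ) ^ α * 2 ^ β = (2 : ℚ) ^ ((φ.bias : ℕ) : ℤ) := by
      rw [← pow_add, hαβ, zpow_natCast]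
    rw [e]
    unfold Format.quantum Format.qexp
    rw [← zpow_add₀ (by norm_num : (2 : ℚ) ≠ 0),
      show (φ.bias : ℤ) + (1 - (φ.bias : ℤ) - (φ.manBits : ℤ)) = 1 - (φ.manBits : ℤ) by
        ring,
      zpow_sub₀ (by norm_num : (2 : ℚ) ≠ 0), zpow_one, zpow_natCast]
  -- casts of the data and of the midpoint
  have hh : (2 : ℚ) ^ (φ.manBits - 1) = 2 ^ φ.manBits / 2 := by
    rw [eq_div_iff (by norm_num : (2 : ℚ) ≠ 0)]
    exact_mod_cast hhalf
  have hA : (((2 ^ (φ.manBits - 1) + 1) * 2 ^ α : ℕ) : ℚ)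
      = (2 ^ φ.manBits / 2 + 1) * 2 ^ α := by
    push_cast
    rw [hh]
  have hB : (((2 ^ (φ.manBits + 1) - 1) * 2 ^ β : ℕ) : ℚ)
      = (2 * 2 ^ φ.manBits - 1) * 2 ^ β := by
    rw [Nat.cast_mul, Nat.cast_sub Nat.one_le_two_pow]
    push_cast
    ring
  have hT : (((2 * (2 ^ φ.manBits + 1) + 1) * 2 ^ 0 : ℕ) : ℚ) = 2 * 2 ^ φ.manBits + 3 := by
    push_cast
    ring
  -- the product: `a·b = μ - δ`, `μ = (2^(m+1) + 3)·q`, `δ = (2/2^m)·q`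
  set δ : ℚ := 2 / 2 ^ φ.manBits * φ.quantum with hδ
  have hX0 : (0 : ℚ) < 2 ^ φ.manBits := by positivity
  have hprod : a.toRat * b.toRat
      = (((2 * (2 ^ φ.manBits + 1) + 1) * 2 ^ 0 : ℕ) : ℚ) * φ.quantum - δ := by
    rw [ha', hb', hA, hB, hT, hδ]
    calc (2 ^ φ.manBits / 2 + 1) * 2 ^ α * φ.quantum
          * ((2 * 2 ^ φ.manBits - 1) * 2 ^ β * φ.quantum)
        = (2 ^ φ.manBits / 2 + 1) * (2 * 2 ^ φ.manBits - 1)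
            * ((2 : ℚ) ^ α * 2 ^ β * φ.quantum) * φ.quantum := by ring
      _ = (2 ^ φ.manBits / 2 + 1) * (2 * 2 ^ φ.manBits - 1) * (2 / 2 ^ φ.manBits)
            * φ.quantum := by rw [hunit]
      _ = (2 * 2 ^ φ.manBits + 3) * φ.quantum - 2 / 2 ^ φ.manBits * φ.quantum := by
            field_simp
            ring
  have hδ0 : 0 < δ := by
    rw [hδ]
    positivity
  have hX8 : (8 : ℚ) ≤ 2 ^ φ.manBits := by exact_mod_cast h8
  have hδq : δ < 2 ^ 0 * φ.quantum := by
    rw [hδ, pow_zero, one_mul, div_mul_eq_mul_div, div_lt_iff₀ hX0]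
    nlinarith [hq0, hX8]
  have hεψ : 2 * |(-δ)| < ψ.quantum := by
    rw [abs_neg, abs_of_pos hδ0, hQ, hδ, div_mul_eq_mul_div, mul_div_assoc', div_lt_iff₀ hX0]
    nlinarith [hq0, hX8]
  -- (ψ) the register rounds `a·b` UP onto the midpoint `μ`, a value of `ψ`
  have hrepψ : ψ.Representable ((2 * (2 ^ φ.manBits + 1) + 1) * 2 ^ 0) :=
    representable_of_lt_pow (by rw [pow_zero, mul_one]; omega) (by rw [pow_zero, mul_one]; omega)
  have hYr : (roundNE ψ ((((2 * (2 ^ φ.manBits + 1) + 1) * 2 ^ 0 : ℕ) : ℚ) * φ.quantum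
      - δ)).toRat = (((2 * (2 ^ φ.manBits + 1) + 1) * 2 ^ 0 : ℕ) : ℚ) * φ.quantum := by
    have h := toRat_roundNE_natMul_add_small hrepψ hεψ
    rw [sub_eq_add_neg, ← hQ]
    exact h
  -- (φ) the midpoint goes to the EVEN side `2^(m+1) + 4` (odd `t = 2^m + 1`); the product itself
  --     rounds DOWN to `2^(m+1) + 2`
  have hodd : Odd (2 ^ φ.manBits + 1) := (Nat.even_pow.mpr ⟨even_two, by omega⟩).add_one
  have htlo : 2 ^ φ.manBits ≤ 2 ^ φ.manBits + 1 := by omega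
  have hthi : 2 ^ φ.manBits + 1 < 2 ^ (φ.manBits + 1) := by omega
  have hu : (2 ^ φ.manBits + 1 + 1) * 2 ^ (0 + 1) ≤ φ.maxScaled := by
    rw [zero_add, pow_one]
    omega
  have hXμ := toRat_roundNE_gmid_odd (t := 2 ^ φ.manBits + 1) (k := 0) h1 hodd htlo hthi hu
  have hXx := toRat_roundNE_below_gmid (φ := φ) (t := 2 ^ φ.manBits + 1) (k := 0) htlo hthi hu
    hδ0 hδq
  have key := hD a b
  rw [hprod, hYr, hXμ, hXx] at key
  have k2 : (2 ^ φ.manBits + 1 + 1) * 2 ^ (0 + 1) = (2 ^ φ.manBits + 1) * 2 ^ (0 + 1) := by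
    exact_mod_cast mul_right_cancel₀ hq0.ne' key
  simp only [zero_add, pow_one] at k2
  omega

/-! ## §2 The hypothesis as a boolean test; the named records -/

/-- THE HYPOTHESIS OF N-mul-0 AS A BOOLEAN TEST on parameter records: equal quanta, `m_X ≥ 3`,
`m_Y ≥ m_X + 1`, the midpoint and its even neighbour in range of both, and SOME split
`α + β = bias_X` of the scaling with both witness data in range of `X` (`α` searched over
`[0, bias_X]`). [this packet] -/
def drMulSameQTest (X Y : Format) : Bool :=
  decide (Y.qexp = X.qexp) && decide (3 ≤ X.manBits) && decide (X.manBits + 1 ≤ Y.manBits) &&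
  decide (2 ^ (X.manBits + 1) + 4 ≤ X.maxScaled) &&
  decide (2 ^ (X.manBits + 1) + 3 ≤ Y.maxScaled) &&
  (List.range (X.bias + 1)).any fun α =>
    decide ((2 ^ (X.manBits - 1) + 1) * 2 ^ α ≤ X.maxScaled) &&
    decide ((2 ^ (X.manBits + 1) - 1) * 2 ^ (X.bias - α) ≤ X.maxScaled)

/-- SOUNDNESS OF THE TEST: `drMulSameQTest X Y ⟹ ¬ DRMul X Y` (N-mul-0 at the exponents found by
the search). [this packet] -/
theorem not_drMul_of_sameQTest {X Y : Format} (h : drMulSameQTest X Y = true) : ¬ DRMul X Y := by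
  simp only [drMulSameQTest, Bool.and_eq_true, decide_eq_true_eq, List.any_eq_true,
    List.mem_range] at h
  obtain ⟨⟨⟨⟨⟨hq, h3⟩, hP⟩, hX⟩, hY⟩, α, hα1, hα, hβ⟩ := h
  exact not_drMul_of_qexp_eq hq h3 hP (α := α) (β := X.bias - α) (by omega) hα hβ hX hY

/-- THE NAMED `13 × 13` MATRIX: NO named pair is in the regime of N-mul-0 — equal quanta occur
among the named records only for binary8p3 / binary8p3f and binary8p4 / binary8p4f, of equal
precision.  The same-quantum register is a design point, not a named pair. [this packet] -/
theorem drMulSameQ_named : ∀ X ∈ namedFormats, ∀ Y ∈ namedFormats,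
    drMulSameQTest X Y = false := by
  decide

/-! ## §3 Pseudo-record cells at `d = 0`: innocuous iff `P ≤ 3` -/

/-- `P = 2` source: `m = 1`, `bias = 4`, `L = -4`, `M = 24` (deep, roomy; `9` positive values).
[this packet] -/
def Z2 : Format := ⟨1, 4, 4, 1, by decide⟩

/-- Same-quantum register for `Z2`: `P = 4 = 2P`, `L = -4`, `M = 60`. [this packet] -/
def Z2reg : Format := ⟨3, 2, 3, 7, by decide⟩

/-- `P = 3` source: `m = 2`, `bias = 6`, `L = -7`, `M = 224` (`27` positive values).
[this packet] -/
def Z3 : Format := ⟨2, 6, 6, 3, by decide⟩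

/-- Same-quantum register for `Z3`: `P = 6 = 2P`, `L = -7`, `M = 504`. [this packet] -/
def Z3reg : Format := ⟨5, 3, 4, 31, by decide⟩

/-- `P = 4` source: `m = 3`, `bias = 6`, `L = -8`, `M = 480`. [this packet] -/
def Z4 : Format := ⟨3, 6, 6, 7, by decide⟩

/-- Same-quantum register for `Z4`: `P = 8 = 2P`, `L = -8`, `M = 1020`. [this packet] -/
def Z4reg : Format := ⟨7, 2, 3, 127, by decide⟩

/-- `P = 8` source (the bfloat16 precision): `m = 7`, `bias = 10`, `L = -16`, `M = 16320`.
[this packet] -/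
def Q8 : Format := ⟨7, 10, 7, 127, by decide⟩

/-- Same-quantum register for `Q8`: `P = 16 = 2P`, `L = -16`, `M = 65535`. [this packet] -/
def Q8reg : Format := ⟨15, 2, 1, 32767, by decide⟩

/-- Same-quantum register of precision `3` for `Z2` (`P < P_ψ < 2P`): `L = -4`, `M = 56`.
[this packet] -/
def Z2r3 : Format := ⟨2, 3, 4, 3, by decide⟩

/-- Same-quantum register of precision `4` for `Z3`: `L = -7`, `M = 480`. [this packet] -/
def Z3r4 : Format := ⟨3, 5, 6, 7, by decide⟩

/-- Same-quantum register of precision `5` for `Z3`: `L = -7`, `M = 496`. [this packet] -/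
def Z3r5 : Format := ⟨4, 4, 5, 15, by decide⟩

/-- The four cells are embedded pairs (`F_X ⊆ F_Y`) with equal quanta and `P_Y = 2 P_X`.
[this packet] -/
theorem sameQ_embeds : (embedsTest Z2 Z2reg && embedsTest Z3 Z3reg && embedsTest Z4 Z4reg &&
    embedsTest Q8 Q8reg) = true ∧ (Z2reg.qexp = Z2.qexp ∧ Z3reg.qexp = Z3.qexp ∧
    Z4reg.qexp = Z4.qexp ∧ Q8reg.qexp = Q8.qexp) := by
  refine ⟨by decide, by decide⟩

/-- The three strip registers are embedded, same-quantum pairs with `P_X < P_Y < 2 P_X`.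
[this packet] -/
theorem sameQ_strip_embeds : (embedsTest Z2 Z2r3 && embedsTest Z3 Z3r4 &&
    embedsTest Z3 Z3r5) = true ∧
    (Z2r3.qexp = Z2.qexp ∧ Z3r4.qexp = Z3.qexp ∧ Z3r5.qexp = Z3.qexp) := by
  refine ⟨by decide, by decide⟩

set_option maxHeartbeats 4000000 in
/-- THE CELLS: at `d = 0` the `P = 2` and `P = 3` products are innocuous (exhaustion of all
signed operand pairs by the kernel), the `P = 4` and `P = 8` products slip (N-mul-0 via the
test; `Z4`: `5·2^α q · 15·2^β q = 75/4 q ↦ 19 q ↦ 20 q`, directly `18 q`; `Q8`: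
`65·2^α q · 255·2^β q ↦ 259 q ↦ 260 q`, directly `258 q`).  Implementation A
(`mul_sameq_law.py`) finds the same four verdicts by brute force (`24`, `125`, `419`, `94 809`
distinct positive products; least slips `75/4` and `32899/128 = 167·197/2^7` quanta).
[this packet] -/
theorem sameQ_cells :
    (DRMul Z2 Z2reg ∧ DRMul Z3 Z3reg) ∧ (¬ DRMul Z4 Z4reg ∧ ¬ DRMul Q8 Q8reg) :=
  ⟨⟨drMul_of_all (by decide +kernel), drMul_of_all (by decide +kernel)⟩,
    ⟨not_drMul_of_sameQTest (by decide), not_drMul_of_sameQTest (by decide)⟩⟩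

set_option maxHeartbeats 4000000 in
/-- THE STRIP AT `d = 0` FOR THE INNOCUOUS PRECISIONS: the `P = 2` products stay innocuous through
the same-quantum register of precision `3`, the `P = 3` products through those of precision `4`
and `5` (kernel exhaustion; implementation A: `24`, `125`, `125` distinct positive products, no
slip, and no slip on the deep pseudo-records `P ≤ 3`, `P_Y ∈ {P+1, ⌈3P/2⌉}` of its Part 2).
Together with `sameQ_cells`: at equal quanta the threshold is in the SOURCE precision alone.
[this packet] -/
theorem sameQ_strip_cells : DRMul Z2 Z2r3 ∧ DRMul Z3 Z3r4 ∧ DRMul Z3 Z3r5 :=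
  ⟨drMul_of_all (by decide +kernel), drMul_of_all (by decide +kernel),
    drMul_of_all (by decide +kernel)⟩

end Summit.Ventures.CertifiedArithmetic
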